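import Summits.Ventures.Crystal3D.Theorems.StickyWulffConstantTextureLiminfTexShadowBilayerFrameRigidity
import Summits.Ventures.Crystal3D.Theorems.StickyWulffConstantTextureLiminfTexShadowBothFccDefs
import HarnessLib

/-!
# Bilayer frames of an ARBITRARY Barlow plate are framed by the plate's own frame (T-F2 / F_layer building block)

HONEST FRAMING. Venture `Summits/Ventures/Crystal3D` (cell `crystal3d-full`); helper for the crux `CoaxialWallLaw`
(stmt-Ventures-19481, lane F) in its role as owner of lane T's debt T-F2 = `stub_famFaulted` (TexShadow v7; cf-p1 DECISION
(lxxiii), 2026-08-29) and for the crux `TextureLiminf[V5]`.  Census-free lattice bookkeeping, standard axioms; nothing about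
the stubs is claimed; F-C1 not moved.  Sizing memo HOME/wall-19481-p1/T-F2-n3.md §3 (L1)/§5: every per-strip statement about a
FAULTED plate (Hägg word not sign-constant) needs «each bilayer frame `A i` of the plate `stacking L s σ` is Barlow-registered in
the plate's OWN frame `L`», the faulted-plate counterpart of wulff-p2's `bilayerFrame_image_eq` (which needs `BothFcc`).  Here:

* `barlowPos_eq_add_labelDiff_smul` — two Hägg words differ, in layer `k`, by the lateral shift `(L_σ k − L_σ' k)·w`;
* `bilayer_subset_stacking_const` — **the local fcc continuation**: bilayer `i` of `stacking L s σ` lies in the fcc stacking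
  `stacking L s' (fun _ => σ i)` of the SAME frame `L` (explicit `s'`);
* `bilayerFrame_image_eq_frame_or_basalTwin` — for `BilayerFramesAt L s σ A u`: every `A i '' fccRef` is `L '' fccRef` or
  `(basalMirror ≫ L) '' fccRef` (bilayer-frame rigidity);
* **`bilayerFrame_subset_frameStacking`** — `∃ τ, IsHaggSeq τ ∧ A i '' fccRef ⊆ (L· + 0) '' barlowStacking τ`;
* **`sharedAxis_bilayerFrames_of_frame`** — two plates presented with the SAME frame `L` (any origins, any words): every pair
  of bilayer frames shares the axis `L e₃` (`SharedAxis (L e₃) (A₁ i) (A₂ j)`), hence is `CoAx`.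
WHAT THIS IS NOT: no wall inequality; not the strip calculus; F-C1 not moved.
-/

noncomputable section

namespace Summit.Ventures.Crystal3D.Theorems

open Summit.Ventures.Crystal3D
open Summit.Ventures.Crystal3D.TentCertificate (image_fccRef_eq_of_bilayer_subset)
open Literature.MathematicalPhysics.StatisticalMechanics (fccStacking barlowStacking barlowPos barlowOffset haggLabel constHagg
  IsHaggSeq barlowPos_mem barlowPos_apply_two haggLabel_succ basalMirror)
open Summit.Ventures.Crystal3D.Cruxes.TextureLiminf.TexShadow (E3 e₃ fccRef stacking bilayer BilayerFramesAt SharedAxis CoAx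
  stacking_const_neg const_one_eq_constHagg)
open scoped InnerProductSpace

/-! ### Two words, one layer: a lateral shift -/

/-- In layer `k`, the points of two Barlow words differ by the lateral shift `(L_σ k − L_σ' k)·w`. -/
theorem barlowPos_eq_add_labelDiff_smul (a h : ℝ) (σ σ' : ℤ → ℤ) (k i j : ℤ) :
    barlowPos a h σ k i j = barlowPos a h σ' k i j + ((haggLabel σ k - haggLabel σ' k : ℤ) : ℝ) • barlowOffset a := by
  simp only [barlowPos, Int.cast_sub, sub_smul]
  abel

/-- If two words agree at `k`, their label difference is the same in layers `k` and `k + 1`. -/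
theorem haggLabel_sub_succ_of_eq {σ σ' : ℤ → ℤ} {k : ℤ} (h : σ k = σ' k) :
    haggLabel σ (k + 1) - haggLabel σ' (k + 1) = haggLabel σ k - haggLabel σ' k := by
  rw [haggLabel_succ, haggLabel_succ, h]; ring

/-- A constant word with value a letter of a Hägg word is a Hägg word. -/
theorem isHaggSeq_const_letter {σ : ℤ → ℤ} (hσ : IsHaggSeq σ) (i : ℤ) : IsHaggSeq (fun _ : ℤ => σ i) :=
  fun _ => hσ i

/-! ### The local fcc continuation of a bilayer -/

/-- **The local fcc continuation.**  Bilayer `i` of the Barlow plate `stacking L s σ` (ANY Hägg word) lies in the fcc stacking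
of the SAME frame `L` with the constant word `σ i` and the origin shifted laterally by `L ((L_σ i − L_c i)·w)`. -/
theorem bilayer_subset_stacking_const (L : E3 ≃ₗᵢ[ℝ] E3) (s : E3) (σ : ℤ → ℤ) (i : ℤ) :
    bilayer L s σ i ⊆ stacking L (s + L (((haggLabel σ i - haggLabel (fun _ : ℤ => σ i) i : ℤ) : ℝ) • barlowOffset 1))
      (fun _ : ℤ => σ i) := by
  rintro y ⟨r, ⟨hr, hh⟩, rfl⟩
  obtain ⟨k, p, q, rfl⟩ := hr
  have hB : (0 : ℝ) < Real.sqrt (2 / 3) := Real.sqrt_pos.2 (by norm_num)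
  -- the layer index is `i` or `i + 1`
  have hk : k = i ∨ k = i + 1 := by
    rw [barlowPos_apply_two] at hh
    rcases hh with hh | hh
    · left; exact_mod_cast mul_right_cancel₀ hB.ne' hh
    · right
      have : ((k : ℝ)) = (i : ℝ) + 1 := mul_right_cancel₀ hB.ne' hh
      exact_mod_cast this
  -- in both layers the lateral shift is the same
  have hΔ : haggLabel σ k - haggLabel (fun _ : ℤ => σ i) k = haggLabel σ i - haggLabel (fun _ : ℤ => σ i) i := by
    rcases hk with rfl | rfl
    · rfl
    · exact haggLabel_sub_succ_of_eq rfl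
  refine ⟨barlowPos 1 (Real.sqrt (2 / 3)) (fun _ : ℤ => σ i) k p q, barlowPos_mem k p q, ?_⟩
  simp only
  rw [barlowPos_eq_add_labelDiff_smul 1 (Real.sqrt (2 / 3)) σ (fun _ : ℤ => σ i) k p q, hΔ, map_add]
  abel

/-- **An affine fcc lattice of frame `L` or `basalMirror ≫ L` contains the bilayer.** -/
theorem exists_affine_fcc_supset_bilayer {σ : ℤ → ℤ} (hσ : IsHaggSeq σ) (L : E3 ≃ₗᵢ[ℝ] E3) (s : E3) (i : ℤ) :
    ∃ (P : E3 ≃ₗᵢ[ℝ] E3) (s' : E3), (P = L ∨ P = basalMirror.trans L) ∧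
      bilayer L s σ i ⊆ (fun p => P p + s') '' fccStacking 1 (Real.sqrt (2 / 3)) := by
  obtain ⟨P, hP, hst⟩ := Cruxes.TextureLiminf.TexShadow.exists_affine_fcc_of_const L
    (s + L (((haggLabel σ i - haggLabel (fun _ : ℤ => σ i) i : ℤ) : ℝ) • barlowOffset 1)) (isHaggSeq_const_letter hσ i)
    (fun _ => rfl)
  exact ⟨P, _, hP, by rw [← hst]; exact bilayer_subset_stacking_const L s σ i⟩

/-! ### Bilayer frames are framed by `L` -/

/-- **Every bilayer frame of a Barlow plate has the linear lattice of `L` or of its basal twin `basalMirror ≫ L`.** -/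
theorem bilayerFrame_image_eq_frame_or_basalTwin {σ : ℤ → ℤ} (hσ : IsHaggSeq σ) {L : E3 ≃ₗᵢ[ℝ] E3} {s : E3}
    {A : ℤ → (E3 ≃ₗᵢ[ℝ] E3)} {u : ℤ → E3} (hfr : BilayerFramesAt L s σ A u) (i : ℤ) :
    A i '' fccRef = L '' fccRef ∨ A i '' fccRef = (basalMirror.trans L) '' fccRef := by
  obtain ⟨P, s', hP, hsub⟩ := exists_affine_fcc_supset_bilayer hσ L s i
  have heq : A i '' fccRef = P '' fccRef := image_fccRef_eq_of_bilayer_subset hσ L s i (hfr i) hsub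
  rcases hP with rfl | rfl
  · exact Or.inl heq
  · exact Or.inr heq

/-- `L '' Λ₀` is the `L`-framed Barlow stacking of the all-`(+1)` word through the origin. -/
theorem image_fccRef_eq_frameStacking (L : E3 ≃ₗᵢ[ℝ] E3) :
    L '' fccRef = (fun p => L p + (0 : E3)) '' barlowStacking 1 (Real.sqrt (2 / 3)) constHagg := by
  simp only [add_zero]; rfl

/-- `(basalMirror ≫ L) '' Λ₀` is the `L`-framed Barlow stacking of the all-`(−1)` word through the origin. -/
theorem image_basalTwin_fccRef_eq_frameStacking (L : E3 ≃ₗᵢ[ℝ] E3) :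
    (basalMirror.trans L) '' fccRef = (fun p => L p + (0 : E3)) '' barlowStacking 1 (Real.sqrt (2 / 3)) (fun _ => -1) := by
  have h := stacking_const_neg L 0
  simp only [stacking, add_zero, fccRef] at h ⊢
  exact h.symm

/-- **Every bilayer frame of a Barlow plate is Barlow-registered in the plate's own frame `L`** (through the origin). -/
theorem bilayerFrame_subset_frameStacking {σ : ℤ → ℤ} (hσ : IsHaggSeq σ) {L : E3 ≃ₗᵢ[ℝ] E3} {s : E3}
    {A : ℤ → (E3 ≃ₗᵢ[ℝ] E3)} {u : ℤ → E3} (hfr : BilayerFramesAt L s σ A u) (i : ℤ) :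
    ∃ τ : ℤ → ℤ, IsHaggSeq τ ∧ A i '' fccRef ⊆ (fun p => L p + (0 : E3)) '' barlowStacking 1 (Real.sqrt (2 / 3)) τ := by
  rcases bilayerFrame_image_eq_frame_or_basalTwin hσ hfr i with h | h
  · exact ⟨constHagg, fun _ => Or.inl rfl, by rw [h, image_fccRef_eq_frameStacking]⟩
  · exact ⟨fun _ => -1, fun _ => Or.inr rfl, by rw [h, image_basalTwin_fccRef_eq_frameStacking]⟩

/-- **Two plates presented with ONE frame `L` (any origins, any Hägg words): every pair of bilayer frames shares the axis
`L e₃`.**  (The shared-normal family of T-F2; for `BothFcc` plates this is the input of `frames_equal_or_coaxial_of_sharedAxis`.) -/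
theorem sharedAxis_bilayerFrames_of_frame {σ₁ σ₂ : ℤ → ℤ} (hσ₁ : IsHaggSeq σ₁) (hσ₂ : IsHaggSeq σ₂) {L : E3 ≃ₗᵢ[ℝ] E3}
    {s₁ s₂ : E3} {A₁ A₂ : ℤ → (E3 ≃ₗᵢ[ℝ] E3)} {u₁ u₂ : ℤ → E3}
    (hfr₁ : BilayerFramesAt L s₁ σ₁ A₁ u₁) (hfr₂ : BilayerFramesAt L s₂ σ₂ A₂ u₂) (i j : ℤ) :
    SharedAxis (L e₃) (A₁ i) (A₂ j) := by
  obtain ⟨τ, hτ, h₁⟩ := bilayerFrame_subset_frameStacking hσ₁ hfr₁ i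
  obtain ⟨τ', hτ', h₂⟩ := bilayerFrame_subset_frameStacking hσ₂ hfr₂ j
  exact ⟨L, 0, 0, τ, τ', hτ, hτ', rfl, h₁, h₂⟩

/-- In particular every such pair of bilayer frames is `CoAx`. -/
theorem coAx_bilayerFrames_of_frame {σ₁ σ₂ : ℤ → ℤ} (hσ₁ : IsHaggSeq σ₁) (hσ₂ : IsHaggSeq σ₂) {L : E3 ≃ₗᵢ[ℝ] E3}
    {s₁ s₂ : E3} {A₁ A₂ : ℤ → (E3 ≃ₗᵢ[ℝ] E3)} {u₁ u₂ : ℤ → E3}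
    (hfr₁ : BilayerFramesAt L s₁ σ₁ A₁ u₁) (hfr₂ : BilayerFramesAt L s₂ σ₂ A₂ u₂) (i j : ℤ) :
    CoAx (A₁ i) (A₂ j) :=
  ⟨L e₃, sharedAxis_bilayerFrames_of_frame hσ₁ hσ₂ hfr₁ hfr₂ i j⟩

end Summit.Ventures.Crystal3D.Theorems

end
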